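import Summits.QuantumFields.QCD.Theses.SpectralDefectExtinction
import Summits.QuantumFields.QCD.Theorems.ExtinctionBuildsQCD.Negative.WithoutTightCollapse
import Summits.QuantumFields.QCD.Theorems.WindowExtinction.Negative.SpectralFlowLocal
import Literature.MathematicalPhysics.QuantumFieldTheory.QCDPhaseQuenched
import Literature.MathematicalPhysics.QuantumFieldTheory.SpectralDefectDensity
import Literature.LinearAlgebra.Matrix.HermitianEigenvaluePerturbation

/-!
# Stub `stub_coareaExpectation` of line `hermitian-flow-coarea`
(crux `Summit.QuantumFields.QCD.Theses.SpectralDefectExtinction.TipPricing`, item stmt-QuantumFields-8967)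

**What is proved.** The Fatou/Tonelli lift `CoareaPointwise → CountMeasurable → CoareaExpectation` of
the pointwise coarea inequality for the Hermitian flow `H_U(t) = Γ₅ D_W(U,−t,1)` to phase-quenched
Wilson means with an arbitrary continuous weight `w ≥ 0` on `SU(3)` gauge fields of the four-torus.

Write `R(U) := #{real eigenvalues of D_W(U,0,1) in (t₁,t₂)}` (with algebraic multiplicity, as a
root count of the characteristic polynomial), `N_U(t,η) := #{eigenvalues of H_U(t) in (−η,η)}` and
`I_U(η) := ∫_{t₁}^{t₂} N_U(t,η) dt`.  Hypothesis 1 (pointwise coarea) says that for every `U` there is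
`ε₀(U) > 0` with `2η R(U) ≤ I_U(η)` for `η ∈ (0, ε₀(U))`; Hypothesis 2 gives joint measurability of
`(U,t) ↦ N_U(t,η)` and measurability of `R`.  The conclusion: for every torus side `L`, coupling `β`,
continuous `w ≥ 0`, `t₁ < t₂` and `δ > 0`, for all sufficiently small `η > 0`,
`2η ∫ R w dμ_W ≤ ∫_{t₁}^{t₂} (∫ N_U(t,η) w(U) dμ_W) dt + 2ηδ`.

**Proof.** Abstract measure theory on a finite measure space (`coareaExp_lift`), then specialised.
(1) Pointwise, `liminf_{η→0⁺} I_U(η) w(U)/(2η) ≥ R(U) w(U)` (Hypothesis 1).  (2) Fatou's lemma along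
the countably generated filter `𝓝[>] 0` (`MeasureTheory.lintegral_liminf_le'`, in `ℝ≥0∞` after
`ENNReal.ofReal`; the functions `U ↦ I_U(η)` are measurable as parametric integrals of a jointly
measurable function, `StronglyMeasurable.integral_prod_right`) gives
`∫ R w dμ ≤ liminf_{η→0⁺} (2η)⁻¹ ∫ I_U(η) w dμ`, whence `∫ R w − δ < (2η)⁻¹ ∫ I_U(η) w dμ` for all small
`η > 0` (`Filter.eventually_lt_of_lt_liminf`; the case `∫ R w ≤ δ` is trivial because the double
integral is non-negative).  (3) Tonelli/Fubini (`MeasureTheory.integral_integral_swap`; the integrand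
`N w` is jointly measurable and bounded by `12L⁴ · sup w`, `sup w < ∞` by compactness of the
configuration space, on the finite measure `μ_W ⊗ dt|_{(t₁,t₂]}`) identifies `∫ I_U(η) w dμ` with
`∫_{t₁}^{t₂} ∫ N w dμ dt`.  The root counts are bounded by `Fintype.card` of the quark index
(`Polynomial.card_roots'`, `Matrix.charpoly_natDegree_eq_dim`).

Sources: standard (Fatou, Tonelli); no named facts are used.
-/

noncomputable section

namespace Summit.QuantumFields.QCD.Cruxes.TipPricing.HermitianFlowCoarea

open scoped BigOperators Topology Classical MeasureTheory Matrix ComplexConjugate ENNReal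
open Filter MeasureTheory
open Literature.MathematicalPhysics.QuantumLattice Literature.MathematicalPhysics.QuantumFieldTheory
  Literature.Probability.LatticeModels
open Summit.QuantumFields.QCD.Theses.SpectralDefectExtinction

/-- A parametric interval integral of a jointly measurable real function is measurable in the
parameter. -/
private theorem coareaExp_measurable_intervalIntegral {X : Type*} [MeasurableSpace X]
    (F : X → ℝ → ℝ) (hF : Measurable (Function.uncurry F)) (a b : ℝ) :
    Measurable fun x => ∫ t in a..b, F x t := by
  simp only [intervalIntegral]
  exact (hF.stronglyMeasurable.integral_prod_right
      (ν := volume.restrict (Set.Ioc a b))).measurable.sub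
    (hF.stronglyMeasurable.integral_prod_right
      (ν := volume.restrict (Set.Ioc b a))).measurable

/-- Tonelli/Fubini for a bounded jointly measurable integrand times a bounded measurable weight on a
finite measure space and a finite interval: the `t`-integral of the weighted mean is the weighted mean
of the `t`-integral. -/
private theorem coareaExp_swap {X : Type*} [MeasurableSpace X] (μ : Measure X) [IsFiniteMeasure μ]
    (F : X → ℝ → ℝ) (hF : Measurable (Function.uncurry F)) (w : X → ℝ) (hw : Measurable w) (C : ℝ)
    (hC : ∀ x t, ‖F x t * w x‖ ≤ C) {a b : ℝ} (hab : a ≤ b) :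
    ∫ t in a..b, ∫ x, F x t * w x ∂μ = ∫ x, (∫ t in a..b, F x t) * w x ∂μ := by
  simp_rw [intervalIntegral.integral_of_le hab]
  have hint : Integrable (Function.uncurry fun x t => F x t * w x)
      (μ.prod (volume.restrict (Set.Ioc a b))) :=
    Integrable.of_bound (hF.mul (hw.comp measurable_fst)).aestronglyMeasurable C
      (ae_of_all _ fun p => hC p.1 p.2)
  rw [← integral_integral_swap hint]
  exact integral_congr_ae (ae_of_all _ fun x => integral_mul_const (w x) (F x))

/-- A root count of the characteristic polynomial of a square matrix is at most the dimension. -/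
private theorem coareaExp_countP_roots_le {n : Type*} {_ : Fintype n} {_ : DecidableEq n}
    (M : Matrix n n ℂ) (p : ℂ → Prop) {_ : DecidablePred p} :
    (M.charpoly.roots.countP p : ℝ) ≤ Fintype.card n := by
  have h1 := M.charpoly.roots.countP_le_card p
  have h2 := M.charpoly.card_roots'
  rw [Matrix.charpoly_natDegree_eq_dim] at h2
  exact_mod_cast h1.trans h2

/-- **The abstract lift.** On a finite measure space, let `R ≥ 0` be measurable and bounded, let
`N η` be jointly measurable, non-negative and bounded for every `η`, and let `w ≥ 0` be measurable and
bounded.  If pointwise `2ε R(x) ≤ ∫_{t₁}^{t₂} N ε x t dt` for all small `ε > 0` (smallness depending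
on `x`), then for every `δ > 0` and all small `η > 0`,
`2η ∫ R w dμ ≤ ∫_{t₁}^{t₂} ∫ N η x t · w x dμ dt + 2ηδ` (Fatou along `𝓝[>] 0` + Tonelli). -/
private theorem coareaExp_lift {X : Type*} [MeasurableSpace X] (μ : Measure X) [IsFiniteMeasure μ]
    (R : X → ℝ) (N : ℝ → X → ℝ → ℝ) (w : X → ℝ) (K W : ℝ)
    (hRm : Measurable R) (hNm : ∀ η, Measurable (Function.uncurry (N η)))
    (hwm : Measurable w) (hw0 : ∀ x, 0 ≤ w x) (hwW : ∀ x, w x ≤ W)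
    (hR0 : ∀ x, 0 ≤ R x) (hRK : ∀ x, R x ≤ K) (hN0 : ∀ η x t, 0 ≤ N η x t)
    (hNK : ∀ η x t, N η x t ≤ K) {t₁ t₂ : ℝ} (ht : t₁ < t₂)
    (hpt : ∀ x, ∃ ε₀ : ℝ, 0 < ε₀ ∧ ∀ ε : ℝ, 0 < ε → ε < ε₀ →
      2 * ε * R x ≤ ∫ t in t₁..t₂, N ε x t)
    {δ : ℝ} (hδ : 0 < δ) :
    ∃ η₀ : ℝ, 0 < η₀ ∧ ∀ η : ℝ, 0 < η → η < η₀ →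
      2 * η * (∫ x, R x * w x ∂μ) ≤ (∫ t in t₁..t₂, ∫ x, N η x t * w x ∂μ) + 2 * η * δ := by
  set a : ℝ := ∫ x, R x * w x ∂μ with ha
  -- the double integral is non-negative
  have hdouble : ∀ η, 0 ≤ ∫ t in t₁..t₂, ∫ x, N η x t * w x ∂μ := fun η =>
    intervalIntegral.integral_nonneg ht.le fun t _ =>
      integral_nonneg fun x => mul_nonneg (hN0 η x t) (hw0 x)
  by_cases haδ : a ≤ δ
  · refine ⟨1, one_pos, fun η hη _ => ?_⟩
    have h1 : 2 * η * a ≤ 2 * η * δ := mul_le_mul_of_nonneg_left haδ (by positivity)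
    linarith [hdouble η]
  rw [not_le] at haδ
  -- the `t`-integrated window count `I η x = ∫_{t₁}^{t₂} N η x t dt`
  set I : ℝ → X → ℝ := fun η x => ∫ t in t₁..t₂, N η x t with hI
  have hIm : ∀ η, Measurable (I η) := fun η =>
    coareaExp_measurable_intervalIntegral (N η) (hNm η) t₁ t₂
  have hI0 : ∀ η x, 0 ≤ I η x := fun η x =>
    intervalIntegral.integral_nonneg ht.le fun t _ => hN0 η x t
  have hIK : ∀ η x, I η x ≤ K * |t₂ - t₁| := by
    intro η x
    have h := intervalIntegral.norm_integral_le_of_norm_le_const (a := t₁) (b := t₂) (C := K)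
      (f := fun t => N η x t) fun t _ => by
        rw [Real.norm_eq_abs, abs_of_nonneg (hN0 η x t)]; exact hNK η x t
    rw [Real.norm_eq_abs] at h
    exact (le_abs_self _).trans h
  -- Fatou along `𝓝[>] 0` for `f η x = (2η)⁻¹ I η x · w x` (in `ℝ≥0∞`)
  set f : ℝ → X → ℝ≥0∞ := fun η x => ENNReal.ofReal ((2 * η)⁻¹ * (I η x * w x)) with hf
  have hfm : ∀ η, Measurable (f η) := fun η =>
    (((hIm η).mul hwm).const_mul _).ennreal_ofReal
  have hptw : ∀ x, ENNReal.ofReal (R x * w x) ≤ liminf (fun η => f η x) (𝓝[>] (0 : ℝ)) := by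
    intro x
    obtain ⟨ε₀, hε₀, hε⟩ := hpt x
    refine le_liminf_of_le (h := ?_)
    filter_upwards [Ioo_mem_nhdsGT hε₀] with η hη
    refine ENNReal.ofReal_le_ofReal ?_
    have h2 : (0 : ℝ) < 2 * η := by linarith [hη.1]
    have hle : 2 * η * R x ≤ I η x := hε η hη.1 hη.2
    calc R x * w x = (2 * η)⁻¹ * (2 * η * R x * w x) := by
          rw [← mul_assoc, ← mul_assoc, inv_mul_cancel₀ h2.ne', one_mul]
      _ ≤ (2 * η)⁻¹ * (I η x * w x) :=
          mul_le_mul_of_nonneg_left (mul_le_mul_of_nonneg_right hle (hw0 x)) (inv_nonneg.2 h2.le)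
  have hFatou := lintegral_liminf_le' (μ := μ) (u := 𝓝[>] (0 : ℝ)) (f := f)
    fun η => (hfm η).aemeasurable
  have hRint : Integrable (fun x => R x * w x) μ :=
    Integrable.of_bound (hRm.mul hwm).aestronglyMeasurable (K * W) (ae_of_all _ fun x => by
      rw [Real.norm_eq_abs, abs_of_nonneg (mul_nonneg (hR0 x) (hw0 x))]
      exact mul_le_mul (hRK x) (hwW x) (hw0 x) ((hR0 x).trans (hRK x)))
  have hkey : ENNReal.ofReal a ≤ liminf (fun η => ∫⁻ x, f η x ∂μ) (𝓝[>] (0 : ℝ)) := by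
    rw [ha, ofReal_integral_eq_lintegral_ofReal hRint
      (ae_of_all _ fun x => mul_nonneg (hR0 x) (hw0 x))]
    exact (lintegral_mono fun x => hptw x).trans hFatou
  have hlt : ENNReal.ofReal (a - δ) < liminf (fun η => ∫⁻ x, f η x ∂μ) (𝓝[>] (0 : ℝ)) :=
    lt_of_lt_of_le ((ENNReal.ofReal_lt_ofReal_iff (by linarith)).2 (by linarith)) hkey
  have hev : ∀ᶠ η in 𝓝[>] (0 : ℝ), ENNReal.ofReal (a - δ) < ∫⁻ x, f η x ∂μ :=
    eventually_lt_of_lt_liminf hlt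
  obtain ⟨η₀, hη₀, hsub⟩ := mem_nhdsGT_iff_exists_Ioo_subset.1 hev
  refine ⟨η₀, hη₀, fun η hη hηη₀ => ?_⟩
  have hP : ENNReal.ofReal (a - δ) < ∫⁻ x, f η x ∂μ := hsub ⟨hη, hηη₀⟩
  have h2η : (0 : ℝ) < 2 * η := by positivity
  -- the Bochner form of `∫⁻ f η`
  have hIwint : Integrable (fun x => I η x * w x) μ :=
    Integrable.of_bound ((hIm η).mul hwm).aestronglyMeasurable (K * |t₂ - t₁| * W)
      (ae_of_all _ fun x => by
        rw [Real.norm_eq_abs, abs_of_nonneg (mul_nonneg (hI0 η x) (hw0 x))]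
        exact mul_le_mul (hIK η x) (hwW x) (hw0 x) ((hI0 η x).trans (hIK η x)))
  have hlint : ∫⁻ x, f η x ∂μ = ENNReal.ofReal ((2 * η)⁻¹ * ∫ x, I η x * w x ∂μ) := by
    rw [← integral_const_mul]
    exact (ofReal_integral_eq_lintegral_ofReal (hIwint.const_mul _) (ae_of_all _ fun x =>
      mul_nonneg (inv_nonneg.2 h2η.le) (mul_nonneg (hI0 η x) (hw0 x)))).symm
  rw [hlint] at hP
  have hP' : a - δ < (2 * η)⁻¹ * ∫ x, I η x * w x ∂μ := (ENNReal.ofReal_lt_ofReal_iff'.1 hP).1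
  -- Tonelli
  have hswap : (∫ t in t₁..t₂, ∫ x, N η x t * w x ∂μ) = ∫ x, I η x * w x ∂μ :=
    coareaExp_swap μ (N η) (hNm η) w hwm (K * W) (fun x t => by
      rw [Real.norm_eq_abs, abs_of_nonneg (mul_nonneg (hN0 η x t) (hw0 x))]
      exact mul_le_mul (hNK η x t) (hwW x) (hw0 x) ((hN0 η x t).trans (hNK η x t))) ht.le
  rw [hswap]
  have h3 : 2 * η * (a - δ) < ∫ x, I η x * w x ∂μ := by
    have := mul_lt_mul_of_pos_left hP' h2η
    rwa [mul_inv_cancel_left₀ h2η.ne'] at this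
  nlinarith [h3]

/-- **STUB 3 · `stub_coareaExpectation`** — Fatou/Tonelli lift of the pointwise coarea inequality to
phase-quenched means with a continuous non-negative weight (`CoareaPointwise → CountMeasurable → CoareaExpectation`). -/
theorem stub_coareaExpectation :
    (∀ (L : ℕ) [NeZero L] (U : GaugeConfig 4 L SU3) (t₁ t₂ : ℝ), t₁ < t₂ → ∃ ε₀ : ℝ, 0 < ε₀ ∧ ∀ ε :
      ℝ, 0 < ε → ε < ε₀ → 2 * ε * (Multiset.countP (fun z : ℂ => z.im = 0 ∧ t₁ < z.re ∧ z.re < t₂)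
      (wilsonDirac (fundamentalRep (Fin 3)) U 0 1).charpoly.roots : ℝ) ≤ ∫ t in t₁..t₂,
      (Multiset.countP (fun z : ℂ => |z.re| < ε) (spinorLift gammaFive * wilsonDirac (fundamentalRep
      (Fin 3)) U (-t) 1).charpoly.roots : ℝ)) → ((∀ (L : ℕ) [NeZero L] (η : ℝ), Measurable fun p :
      GaugeConfig 4 L SU3 × ℝ => Multiset.countP (fun z : ℂ => |z.re| < η) (spinorLift gammaFive *
      wilsonDirac (fundamentalRep (Fin 3)) p.1 (-p.2) 1).charpoly.roots) ∧ (∀ (L : ℕ) [NeZero L] (t₁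
      t₂ : ℝ), Measurable fun U : GaugeConfig 4 L SU3 => Multiset.countP (fun z : ℂ => z.im = 0 ∧ t₁
      < z.re ∧ z.re < t₂) (wilsonDirac (fundamentalRep (Fin 3)) U 0 1).charpoly.roots)) → (∀ (L : ℕ)
      [NeZero L] (β : ℝ) (w : GaugeConfig 4 L SU3 → ℝ), Continuous w → (∀ U, 0 ≤ w U) → ∀ t₁ t₂ : ℝ,
      t₁ < t₂ → ∀ δ : ℝ, 0 < δ → ∃ η₀ : ℝ, 0 < η₀ ∧ ∀ η : ℝ, 0 < η → η < η₀ → 2 * η * (∫ U,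
      (Multiset.countP (fun z : ℂ => z.im = 0 ∧ t₁ < z.re ∧ z.re < t₂) (wilsonDirac (fundamentalRep
      (Fin 3)) U 0 1).charpoly.roots : ℝ) * w U ∂(wilsonMeasure (fundamentalRep (Fin 3)) β : Measure
      (GaugeConfig 4 (L) SU3))) ≤ (∫ t in t₁..t₂, (∫ U, (Multiset.countP (fun z : ℂ => |z.re| < η)
      (spinorLift gammaFive * wilsonDirac (fundamentalRep (Fin 3)) U (-t) 1).charpoly.roots : ℝ) * w
      U ∂(wilsonMeasure (fundamentalRep (Fin 3)) β : Measure (GaugeConfig 4 (L) SU3)))) + 2 * η * δ) := by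
  intro hPt hMeas L _ β w hw hw0 t₁ t₂ ht δ hδ
  -- the continuous weight is bounded on the compact configuration space
  obtain ⟨W, hW⟩ : ∃ W : ℝ, ∀ U : GaugeConfig 4 L SU3, w U ≤ W := by
    obtain ⟨U₀, -, hU₀⟩ := (isCompact_univ (X := GaugeConfig 4 L SU3)).exists_isMaxOn
      Set.univ_nonempty hw.continuousOn
    exact ⟨w U₀, fun U => hU₀ (Set.mem_univ U)⟩
  exact coareaExp_lift (μ := (wilsonMeasure (fundamentalRep (Fin 3)) β : Measure
      (GaugeConfig 4 L SU3)))
    (R := fun U => (Multiset.countP (fun z : ℂ => z.im = 0 ∧ t₁ < z.re ∧ z.re < t₂)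
      (wilsonDirac (fundamentalRep (Fin 3)) U 0 1).charpoly.roots : ℝ))
    (N := fun η U t => (Multiset.countP (fun z : ℂ => |z.re| < η)
      (spinorLift gammaFive * wilsonDirac (fundamentalRep (Fin 3)) U (-t) 1).charpoly.roots : ℝ))
    (w := w) (K := Fintype.card (QuarkIdx L)) (W := W)
    (measurable_from_top.comp (hMeas.2 L t₁ t₂))
    (fun η => measurable_from_top.comp (hMeas.1 L η))
    hw.measurable hw0 hW (fun U => Nat.cast_nonneg _) (fun U => coareaExp_countP_roots_le _ _)
    (fun η U t => Nat.cast_nonneg _) (fun η U t => coareaExp_countP_roots_le _ _) ht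
    (fun U => hPt L U t₁ t₂ ht) hδ

end Summit.QuantumFields.QCD.Cruxes.TipPricing.HermitianFlowCoarea

end
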